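import Mathlib
import Summits.Ventures.PercRepro2.Defs
import Summits.Ventures.PercRepro2.Independence
import Summits.Ventures.PercRepro2.Harris
import Summits.Ventures.PercRepro2.Graph
import Summits.Ventures.PercRepro2.Exploration
import Summits.Ventures.PercRepro2.Events

/-!
# Residual weights: the graph `G ∖ W` as the product measure with the edges touching `W` closed
(blind cell PercRepro2, mine-1 g7; tools for the mean-field bound `Xexact ≤ Xhat` of ZMean.lean)

`connDelEvent ends W u w = {ω | Conn ends (restrict (touches ends ↑W)ᶜ ω) u w}` reads connections in
the graph with every edge touching `W` closed.  Under the product measure `p`, the probability of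
any event read through `restrict Fᶜ` equals the probability of the event itself under the weights
`zeroOn p F` (the edges of `F` pinned closed): **`prob_restrict_eq`**.  Hence the BHK and Harris
inequalities transfer verbatim to the residual vocabulary (`prob_connDelEvent`,
`prob_restrict_inter`).
-/

namespace Summit.Ventures.PercRepro2

section ZeroOn

variable {E : Type*} [Fintype E] [DecidableEq E] {R : Type*} [CommRing R]

/-- The weights `p` with every edge of `F` pinned closed. -/
def zeroOn (p : E → R) (F : Set E) [DecidablePred (· ∈ F)] : E → R :=
  fun e => if e ∈ F then 0 else p e

omit [Fintype E] [DecidableEq E] in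
/-- `zeroOn` on an edge of `F`. -/
lemma zeroOn_of_mem (p : E → R) (F : Set E) [DecidablePred (· ∈ F)] {e : E} (h : e ∈ F) :
    zeroOn p F e = 0 := by simp [zeroOn, h]

omit [Fintype E] [DecidableEq E] in
/-- `zeroOn` on an edge outside `F`. -/
lemma zeroOn_of_notMem (p : E → R) (F : Set E) [DecidablePred (· ∈ F)] {e : E} (h : e ∉ F) :
    zeroOn p F e = p e := by simp [zeroOn, h]

omit [Fintype E] [DecidableEq E] in
/-- `restrict Fᶜ` of a glued configuration closes the `F`-part. -/
lemma restrict_compl_glue (F : Set E) [DecidablePred (· ∈ F)] [DecidablePred (· ∈ Fᶜ)]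
    (σ₁ : {e // e ∈ F} → Bool) (σ₂ : {e // e ∉ F} → Bool) :
    restrict Fᶜ (glue F σ₁ σ₂) = glue F (fun _ => false) σ₂ := by
  funext e
  by_cases h : e ∈ F
  · have h' : e ∉ Fᶜ := fun h'' => h'' h
    simp [restrict, glue, h, h']
  · have h' : e ∈ Fᶜ := h
    simp [restrict, glue, h, h']

omit [DecidableEq E] in
/-- The weight of the `F`-part under the zeroed weights is the indicator of "all closed". -/
lemma weight_zero_eq (F : Set E) [DecidablePred (· ∈ F)] (σ₁ : {e // e ∈ F} → Bool) :
    weight (fun _ : {e // e ∈ F} => (0 : R)) σ₁ = if σ₁ = fun _ => false then 1 else 0 := by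
  unfold weight
  by_cases h : σ₁ = fun _ => false
  · subst h; simp
  · rw [if_neg h]
    obtain ⟨i, hi⟩ : ∃ i, σ₁ i ≠ false := by
      by_contra hc
      exact h (funext fun i => by simpa using fun h' => hc ⟨i, h'⟩)
    have hi' : σ₁ i = true := by simpa using hi
    exact Finset.prod_eq_zero (Finset.mem_univ i) (by simp [hi'])

/-- The left side of `prob_restrict_eq` as a sum over the complement part. -/
lemma prob_restrict_eq_sum (p : E → R) (F : Set E) [DecidablePred (· ∈ F)]
    [DecidablePred (· ∈ Fᶜ)] (A : Set (Config E)) :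
    prob p {ω | restrict Fᶜ ω ∈ A} =
      ∑ σ₂ : {e // e ∉ F} → Bool, weight (fun i : {e // e ∉ F} => p i) σ₂ *
        A.indicator (1 : Config E → R) (glue F (fun _ => false) σ₂) := by
  rw [prob_eq_expect_indicator, expect_eq_sum_glue p _ F]
  have hl : ∀ σ₁ : {e // e ∈ F} → Bool, ∀ σ₂ : {e // e ∉ F} → Bool,
      weight (fun i : {e // e ∈ F} => p i) σ₁ * weight (fun i : {e // e ∉ F} => p i) σ₂ *
          ({ω | restrict Fᶜ ω ∈ A}.indicator (1 : Config E → R) (glue F σ₁ σ₂)) =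
        weight (fun i : {e // e ∈ F} => p i) σ₁ *
          (weight (fun i : {e // e ∉ F} => p i) σ₂ *
            A.indicator (1 : Config E → R) (glue F (fun _ => false) σ₂)) := by
    intro σ₁ σ₂
    have hr : restrict Fᶜ (glue F σ₁ σ₂) = glue F (fun _ => false) σ₂ :=
      restrict_compl_glue F σ₁ σ₂
    have : ({ω | restrict Fᶜ ω ∈ A}.indicator (1 : Config E → R) (glue F σ₁ σ₂)) =
        A.indicator (1 : Config E → R) (glue F (fun _ => false) σ₂) := by
      by_cases hA : glue F (fun _ => false) σ₂ ∈ A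
      · have h1 : glue F σ₁ σ₂ ∈ {ω | restrict Fᶜ ω ∈ A} := by
          show restrict Fᶜ (glue F σ₁ σ₂) ∈ A
          rw [hr]; exact hA
        rw [Set.indicator_of_mem h1, Set.indicator_of_mem hA]; rfl
      · have h1 : glue F σ₁ σ₂ ∉ {ω | restrict Fᶜ ω ∈ A} := by
          show ¬ restrict Fᶜ (glue F σ₁ σ₂) ∈ A
          rw [hr]; exact hA
        rw [Set.indicator_of_notMem h1, Set.indicator_of_notMem hA]
    rw [this]; ring
  simp_rw [hl]
  rw [← Finset.sum_mul_sum, sum_weight, one_mul]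

/-- The right side of `prob_restrict_eq` as the same sum. -/
lemma prob_zeroOn_eq_sum (p : E → R) (F : Set E) [DecidablePred (· ∈ F)] (A : Set (Config E)) :
    prob (zeroOn p F) A =
      ∑ σ₂ : {e // e ∉ F} → Bool, weight (fun i : {e // e ∉ F} => p i) σ₂ *
        A.indicator (1 : Config E → R) (glue F (fun _ => false) σ₂) := by
  rw [prob_eq_expect_indicator, expect_eq_sum_glue (zeroOn p F) _ F]
  have hz : (fun i : {e // e ∈ F} => zeroOn p F i) = fun _ => (0 : R) := by
    funext i; exact zeroOn_of_mem p F i.2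
  have hc : (fun i : {e // e ∉ F} => zeroOn p F i) = fun i : {e // e ∉ F} => p i := by
    funext i; exact zeroOn_of_notMem p F i.2
  rw [hz, hc]
  simp_rw [weight_zero_eq]
  rw [Finset.sum_comm]
  refine Finset.sum_congr rfl fun σ₂ _ => ?_
  rw [Finset.sum_eq_single (fun _ => false)]
  · simp
  · intro σ₁ _ hne; simp [hne]
  · intro h; exact absurd (Finset.mem_univ _) h

/-- **Residual weights**: reading an event through `restrict Fᶜ` is the same as pinning `F` closed:
`prob p {ω | restrict Fᶜ ω ∈ A} = prob (zeroOn p F) A`. -/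
theorem prob_restrict_eq (p : E → R) (F : Set E) [DecidablePred (· ∈ F)]
    [DecidablePred (· ∈ Fᶜ)] (A : Set (Config E)) :
    prob p {ω | restrict Fᶜ ω ∈ A} = prob (zeroOn p F) A := by
  rw [prob_restrict_eq_sum, prob_zeroOn_eq_sum]

omit [Fintype E] [DecidableEq E] in
/-- Pinning edges closed keeps the weights admissible. -/
lemma isProbVec_zeroOn [PartialOrder R] [IsOrderedRing R] {p : E → R} (hp : IsProbVec p)
    (F : Set E) [DecidablePred (· ∈ F)] : IsProbVec (zeroOn p F) := by
  refine ⟨fun e => ?_, fun e => ?_⟩ <;> unfold zeroOn <;> split_ifs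
  · exact le_rfl
  · exact hp.nonneg e
  · exact zero_le_one
  · exact hp.le_one e

end ZeroOn

section Residual

variable {V : Type*} {E : Type*} [Fintype E] [DecidableEq E] [Fintype V] [DecidableEq V]
  {R : Type*} [CommRing R]

omit [Fintype E] [DecidableEq E] in
/-- `connDelEvent` is the `restrict`-preimage of `connEvent`. -/
lemma connDelEvent_eq_preimage (ends : E → Sym2 V) (W : Finset V) (u w : V) :
    connDelEvent ends W u w = {ω | restrict (touches ends ↑W)ᶜ ω ∈ connEvent ends u w} := rfl

/-- Residual connection probabilities are plain connection probabilities under the zeroed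
weights. -/
theorem prob_connDelEvent (p : E → R) (ends : E → Sym2 V) (W : Finset V) (u w : V) :
    prob p (connDelEvent ends W u w) =
      prob (zeroOn p (touches ends ↑W)) (connEvent ends u w) := by
  rw [connDelEvent_eq_preimage, prob_restrict_eq]

/-- The same for an intersection of two residual events. -/
theorem prob_restrict_inter (p : E → R) (ends : E → Sym2 V) (W : Finset V)
    (A B : Set (Config E)) :
    prob p ({ω | restrict (touches ends ↑W)ᶜ ω ∈ A} ∩ {ω | restrict (touches ends ↑W)ᶜ ω ∈ B}) =
      prob (zeroOn p (touches ends ↑W)) (A ∩ B) := by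
  have : ({ω | restrict (touches ends ↑W)ᶜ ω ∈ A} ∩ {ω | restrict (touches ends ↑W)ᶜ ω ∈ B}) =
      {ω | restrict (touches ends ↑W)ᶜ ω ∈ A ∩ B} := by
    ext ω; simp
  rw [this, prob_restrict_eq]

end Residual

end Summit.Ventures.PercRepro2

namespace Summit.Ventures.PercRepro2

/-! ## Partition of the configuration space by the cluster of a vertex -/

section ClusterPartition

variable {V : Type*} {E : Type*} [Fintype E] [DecidableEq E] [Fintype V] [DecidableEq V]
  {R : Type*} [CommRing R]

/-- The cluster of `v` as a `Finset` (the vertices connected to `v`). -/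
def clusterFin (ends : E → Sym2 V) (v : V) (ω : Config E) : Finset V :=
  Finset.univ.filter fun x => Conn ends ω v x

omit [DecidableEq E] in
/-- The coercion of `clusterFin` is the cluster. -/
lemma coe_clusterFin (ends : E → Sym2 V) (v : V) (ω : Config E) :
    (↑(clusterFin ends v ω) : Set V) = cluster ends ω v := by
  ext x; simp [clusterFin, cluster]

omit [DecidableEq E] in
/-- `ω ∈ {C(v) = ↑W}` iff `W` is the cluster finset of `ω`. -/
lemma mem_clusterEvent_coe_iff (ends : E → Sym2 V) (v : V) (W : Finset V) (ω : Config E) :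
    ω ∈ clusterEvent ends v (↑W : Set V) ↔ clusterFin ends v ω = W := by
  rw [mem_clusterEvent, ← coe_clusterFin]
  exact Finset.coe_inj

/-- **Cluster partition**: `P(A) = Σ_W P({C(v) = W} ∩ A)` over all vertex subsets `W`. -/
theorem prob_eq_sum_clusterEvent (p : E → R) (ends : E → Sym2 V) (v : V) (A : Set (Config E)) :
    prob p A = ∑ W : Finset V, prob p (clusterEvent ends v (↑W : Set V) ∩ A) := by
  classical
  unfold prob
  rw [Finset.sum_comm]
  refine Finset.sum_congr rfl fun ω _ => ?_
  rw [Finset.sum_eq_single (clusterFin ends v ω)]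
  · by_cases hA : ω ∈ A
    · have h1 : ω ∈ clusterEvent ends v (↑(clusterFin ends v ω) : Set V) ∩ A :=
        ⟨(mem_clusterEvent_coe_iff ends v _ ω).2 rfl, hA⟩
      rw [Set.indicator_of_mem h1, Set.indicator_of_mem hA]
    · have h1 : ω ∉ clusterEvent ends v (↑(clusterFin ends v ω) : Set V) ∩ A := fun h => hA h.2
      rw [Set.indicator_of_notMem h1, Set.indicator_of_notMem hA]
  · intro W _ hW
    have h1 : ω ∉ clusterEvent ends v (↑W : Set V) ∩ A := fun h =>
      hW ((mem_clusterEvent_coe_iff ends v W ω).1 h.1).symm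
    rw [Set.indicator_of_notMem h1]
  · intro h; exact absurd (Finset.mem_univ _) h

end ClusterPartition

end Summit.Ventures.PercRepro2
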